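import Literature.Analysis.FluidPDE.PlanarGraphBandKinematics
import Literature.Analysis.FluidPDE.PlanarDiagonalFrame
import Literature.Analysis.FluidPDE.PlanarStreamGluing
import Literature.Analysis.FluidPDE.SmoothRampProfiles
import HarnessLib

/-!
# The corner element: a graph band over the diagonal (explicit planar kinematics of a bent channel)

Topic `Literature/Analysis/FluidPDE`. Fifth file of the explicit pullback calculus for the planar
transport equation. A channel that turns a corner — entering heading east, leaving heading south —
is not a graph over `x` or `y`, but along the whole turn the coordinate `u = x - y` increases, so
the channel IS a band around a graph `v = T(u)` in the diagonal frame `(u, v) = (x - y, x + y)` of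
`PlanarDiagonalFrame.lean`. This file assembles the **corner element**: the graph-band move of
`PlanarGraphBandKinematics.lean` (profile `T`, material reparametrisation `Ξ`, stream function
`g (v - T) - P`) read through the frame `A = diagFrame`,

* `cornerScalar Gp T Ξ Ξx t z = Gp ((Ψ_{T,Ξ}(t, A z))₁)` — a transverse profile `Gp` carried by
  the graph-band pullback in frame coordinates;
* `cornerVelocity g gx T Tt Tx t z = A⁻¹ V_{graph}(t, A z)`, `cornerStream g T P t z = ½ H_{graph}(t, A z)`;

and derives everything by composition of the landed lemmas: transport
(`transport_cornerScalar`), incompressibility (`divergence_cornerVelocity`), the stream-function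
form `cornerVelocity = ∇⊥ cornerStream` (`cornerVelocity_eq_perpGrad_cornerStream`, the form
consumed by the gluing of `PlanarStreamGluing.lean`), and joint smoothness. It also records the
**U-standard corner profile** `tentProfile a c ρ u = (u - a) + c - 2·rampAt a ρ u`
(`SmoothRampProfiles.lean`): slope `+1` before the transition, `-1` after it, EXACTLY, so that
off the apex zone the static corner band (`Ξ = id`) is a straight horizontal band
(`cornerScalar_eq_hBand`) resp. a straight vertical band (`cornerScalar_eq_vBand`) — the exact
junction data with the straight elements of a rectilinear channel. Births of corners (graph
shears, `T` depending on `t`), flow of material through a corner and in-place rescaling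
(`Ξ(t,·)` non-trivial) are all instances of the same element.

Folklore (Eulerian method of characteristics in a rotated frame); the role model is the tubular
construction of Alberti–Crippa–Mazzucato, JAMS 32 (2019), §7. The file states no named fact; it
is infrastructure towards a discharge of `acm_compatible_blocks`
(`QuasiSelfSimilarCompatibleBlocks.lean`).

## References

* G. Alberti, G. Crippa, A. L. Mazzucato, *Exponential self-similar mixing by incompressible
  flows*, J. Amer. Math. Soc. 32 (2019), 445–490, §§7–8 (arXiv:1605.02090).
-/

noncomputable section

open Function Set Filter
open scoped Topology ContDiff

namespace Literature.Analysis.FluidPDE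

namespace PlanarKinematics

open Gluing

/-- The plane `ℝ²` as a Euclidean space. [folklore] -/
local notation "E²" => EuclideanSpace ℝ (Fin 2)

variable {G : Type*} [NormedAddCommGroup G] [NormedSpace ℝ G]

/-! ## The corner element: definitions -/

/-- **Corner element, scalar**: the transverse profile `Gp` carried by the graph-band pullback in
the diagonal frame, `Θ(t, z) = Gp ((Ψ_{T,Ξ}(t, A z))₁) = Gp (((A z)₁ - T(t,(A z)₀))/Ξₓ(t,(A z)₀))`.
[folklore] -/
def cornerScalar (Gp : ℝ → G) (T Ξ Ξx : ℝ → ℝ → ℝ) (t : ℝ) (z : E²) : G :=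
  Gp ((graphPullback T Ξ Ξx t (diagFrame z)) 1)

/-- **Corner element, velocity**: the graph-band velocity in frame coordinates pushed to physical
coordinates, `V(t, z) = A⁻¹ V_{graph}(t, A z)`. [folklore] -/
def cornerVelocity (g gx T Tt Tx : ℝ → ℝ → ℝ) (t : ℝ) (z : E²) : E² :=
  diagFrameInv (graphVelocity g gx T Tt Tx t (diagFrame z))

/-- **Corner element, stream function**: `H(t, z) = ½ H_{graph}(t, A z)` (`½ = 1/det A`). [folklore] -/
def cornerStream (g T P : ℝ → ℝ → ℝ) (t : ℝ) (z : E²) : ℝ :=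
  2⁻¹ * graphStream g T P t (diagFrame z)

omit [NormedAddCommGroup G] [NormedSpace ℝ G] in
/-- Unfolding the corner scalar. [folklore] -/
theorem cornerScalar_apply (Gp : ℝ → G) (T Ξ Ξx : ℝ → ℝ → ℝ) (t : ℝ) (z : E²) :
    cornerScalar Gp T Ξ Ξx t z = Gp (((z 0 + z 1) - T t (z 0 - z 1)) / Ξx t (z 0 - z 1)) := by
  simp only [cornerScalar, graphPullback_apply, diagFrame_apply, vec2_apply_zero, vec2_apply_one]

/-- Unfolding the corner velocity. [folklore] -/
theorem cornerVelocity_apply (g gx T Tt Tx : ℝ → ℝ → ℝ) (t : ℝ) (z : E²) :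
    cornerVelocity g gx T Tt Tx t z = diagFrameInv (graphVelocity g gx T Tt Tx t (diagFrame z)) := rfl

/-- Unfolding the corner stream function. [folklore] -/
theorem cornerStream_apply (g T P : ℝ → ℝ → ℝ) (t : ℝ) (z : E²) :
    cornerStream g T P t z = 2⁻¹ * graphStream g T P t (diagFrame z) := rfl

omit [NormedAddCommGroup G] [NormedSpace ℝ G] in
/-- The corner scalar is the frame scalar `w ↦ Gp ((Ψ(t, w))₁)` read through the frame. [folklore] -/
theorem cornerScalar_eq_comp (Gp : ℝ → G) (T Ξ Ξx : ℝ → ℝ → ℝ) (t : ℝ) (z : E²) :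
    cornerScalar Gp T Ξ Ξx t z = (fun w : E² => Gp ((graphPullback T Ξ Ξx t w) 1)) (diagFrame z) := rfl

/-! ## Transport, incompressibility, stream function -/

/-- **The corner element is transported**: with the hypotheses of `graph_pullback_identity` at the
frame point `(t, A z)` and a profile `Gp` differentiable at the transverse reference coordinate,
`∂ₜΘ + D_zΘ[V] = 0` at `(t, z)` for the corner scalar and velocity. [folklore] -/
theorem transport_cornerScalar {Gp : ℝ → G} {T Tt Tx Ξ Ξx Ξt Ξxx Ξxt : ℝ → ℝ → ℝ} {t : ℝ} {z : E²}
    (hG : DifferentiableAt ℝ Gp ((graphPullback T Ξ Ξx t (diagFrame z)) 1))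
    (hT : HasDerivAt (fun s => T s ((diagFrame z) 0)) (Tt t ((diagFrame z) 0)) t)
    (hTx : HasDerivAt (T t) (Tx t ((diagFrame z) 0)) ((diagFrame z) 0))
    (ht : HasDerivAt (fun s => Ξ s ((diagFrame z) 0)) (Ξt t ((diagFrame z) 0)) t)
    (hx : HasDerivAt (Ξ t) (Ξx t ((diagFrame z) 0)) ((diagFrame z) 0))
    (hxx : HasDerivAt (Ξx t) (Ξxx t ((diagFrame z) 0)) ((diagFrame z) 0))
    (hxt : HasDerivAt (fun s => Ξx s ((diagFrame z) 0)) (Ξxt t ((diagFrame z) 0)) t)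
    (hne : Ξx t ((diagFrame z) 0) ≠ 0) :
    deriv (fun s => cornerScalar Gp T Ξ Ξx s z) t +
      fderiv ℝ (cornerScalar Gp T Ξ Ξx t) z
        (cornerVelocity (axialRate Ξx Ξt) (axialRateDeriv Ξx Ξt Ξxx Ξxt) T Tt Tx t z) = 0 := by
  -- the frame scalar `Θf s w = Gp ((Ψ(s, w))₁)` is transported by the graph-band velocity at `(t, A z)`
  set Θf : ℝ → E² → G := fun s w => Gp ((graphPullback T Ξ Ξx s w) 1) with hΘf
  have hf1 : DifferentiableAt ℝ (fun w : E² => w 1) (graphPullback T Ξ Ξx t (diagFrame z)) :=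
    (EuclideanSpace.proj (1 : Fin 2) : E² →L[ℝ] ℝ).differentiableAt
  have hproj : DifferentiableAt ℝ (fun w : E² => Gp (w 1)) (graphPullback T Ξ Ξx t (diagFrame z)) :=
    hG.comp (graphPullback T Ξ Ξx t (diagFrame z)) hf1
  have hframe := transport_comp_graphPullback (Θ := fun w : E² => Gp (w 1)) hproj hT hTx ht hx hxx hxt hne
  -- differentiability of the frame slice at `A z`
  have hslice : DifferentiableAt ℝ (Θf t) (diagFrame z) :=
    hproj.comp _ (hasFDerivAt_graphPullback hTx hx hxx hne).differentiableAt
  have h := transport_conj_diagFrame (Θ := Θf)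
    (V := graphVelocity (axialRate Ξx Ξt) (axialRateDeriv Ξx Ξt Ξxx Ξxt) T Tt Tx) hslice hframe
  exact h

/-- **The corner velocity is divergence free** (frame invariance of the divergence and
`divergence_graphVelocity`). [folklore] -/
theorem divergence_cornerVelocity {g gx T Tt Tx : ℝ → ℝ → ℝ} {t : ℝ} {z : E²}
    (hg : HasDerivAt (g t) (gx t ((diagFrame z) 0)) ((diagFrame z) 0))
    (hgx : DifferentiableAt ℝ (gx t) ((diagFrame z) 0))
    (hT : DifferentiableAt ℝ (T t) ((diagFrame z) 0)) (hTt : DifferentiableAt ℝ (Tt t) ((diagFrame z) 0))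
    (hTx : DifferentiableAt ℝ (Tx t) ((diagFrame z) 0)) :
    ∑ j, fderiv ℝ (cornerVelocity g gx T Tt Tx t) z (EuclideanSpace.single j 1) j = 0 := by
  have hV : DifferentiableAt ℝ (graphVelocity g gx T Tt Tx t) (diagFrame z) := by
    have hp0 : DifferentiableAt ℝ (fun w : E² => w 0) (diagFrame z) :=
      (EuclideanSpace.proj (0 : Fin 2) : E² →L[ℝ] ℝ).differentiableAt
    have h0 : ∀ {f : ℝ → ℝ}, DifferentiableAt ℝ f ((diagFrame z) 0) →
        DifferentiableAt ℝ (fun w : E² => f (w 0)) (diagFrame z) :=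
      fun hf => hf.comp (diagFrame z) hp0
    have h1 : DifferentiableAt ℝ (fun w : E² => w 1) (diagFrame z) :=
      (EuclideanSpace.proj (1 : Fin 2) : E² →L[ℝ] ℝ).differentiableAt
    have e : graphVelocity g gx T Tt Tx t = fun w : E² => vec2 (g t (w 0))
        (Tt t (w 0) + Tx t (w 0) * g t (w 0) - (w 1 - T t (w 0)) * gx t (w 0)) := rfl
    rw [e]
    exact ((h0 hg.differentiableAt).smul_const _).add
      ((((h0 hTt).add ((h0 hTx).mul (h0 hg.differentiableAt))).sub
        ((h1.sub (h0 hT)).mul (h0 hgx))).smul_const _)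
  exact divergence_conj_diagFrame_eq_zero hV (divergence_graphVelocity hg hgx hT hTt hTx)

/-- **The corner velocity is the perpendicular gradient of the corner stream function**, provided
`∂P(t,·) = Tₜ(t,·)` at the frame point (the datum `P(t,·)` is an antiderivative of `∂ₜT(t,·)`).
[folklore] -/
theorem cornerVelocity_eq_perpGrad_cornerStream {g gx T Tt Tx P : ℝ → ℝ → ℝ} {t : ℝ} {z : E²}
    (hg : HasDerivAt (g t) (gx t ((diagFrame z) 0)) ((diagFrame z) 0))
    (hT : HasDerivAt (T t) (Tx t ((diagFrame z) 0)) ((diagFrame z) 0))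
    (hP : HasDerivAt (P t) (Tt t ((diagFrame z) 0)) ((diagFrame z) 0)) :
    cornerVelocity g gx T Tt Tx t z = perpGrad (cornerStream g T P t) z := by
  -- in the frame: `V_graph = (∂₁H, -∂₀H)`
  have hframe := graphVelocity_eq_perp_fderiv_graphStream (t := t) (z := diagFrame z) hg hT hP
  -- differentiability of the frame stream function at `A z`
  have hH : DifferentiableAt ℝ (graphStream g T P t) (diagFrame z) :=
    (hasFDerivAt_graphStream hg hT hP).differentiableAt
  rw [cornerVelocity_apply, hframe, diagFrameInv_perp_fderiv hH]
  -- `∇⊥(½ H∘A) = ½ ∇⊥(H∘A)`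
  have hd : DifferentiableAt ℝ (fun w => graphStream g T P t (diagFrame w)) z :=
    differentiableAt_comp_diagFrame hH
  have e : cornerStream g T P t = fun w => 2⁻¹ * graphStream g T P t (diagFrame w) := rfl
  refine vec2_eq_perpGrad ?_ ?_
  · rw [e, fderiv_const_mul hd]; rfl
  · rw [e, fderiv_const_mul hd]; rfl

/-! ## Smoothness -/

/-- **The corner scalar is smooth** when the profile and the one-dimensional data are. [folklore] -/
theorem contDiff_uncurry_cornerScalar {Gp : ℝ → G} {T Ξ Ξx : ℝ → ℝ → ℝ} (hGp : ContDiff ℝ ∞ Gp)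
    (hT : ContDiff ℝ ∞ (uncurry T)) (hΞ : ContDiff ℝ ∞ (uncurry Ξ)) (hΞx : ContDiff ℝ ∞ (uncurry Ξx))
    (hne : ∀ t x, Ξx t x ≠ 0) : ContDiff ℝ ∞ (uncurry (cornerScalar Gp T Ξ Ξx)) := by
  have h1 : ContDiff ℝ ∞ (uncurry fun t w => (fun q : E² => Gp (q 1)) (graphPullback T Ξ Ξx t w)) :=
    contDiff_uncurry_comp_graphPullback (hGp.comp (contDiff_coord 1)) hT hΞ hΞx hne
  exact contDiff_uncurry_comp_diagFrame h1

/-- **The corner velocity is smooth** when its one-dimensional data are. [folklore] -/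
theorem contDiff_uncurry_cornerVelocity {g gx T Tt Tx : ℝ → ℝ → ℝ} (hg : ContDiff ℝ ∞ (uncurry g))
    (hgx : ContDiff ℝ ∞ (uncurry gx)) (hT : ContDiff ℝ ∞ (uncurry T))
    (hTt : ContDiff ℝ ∞ (uncurry Tt)) (hTx : ContDiff ℝ ∞ (uncurry Tx)) :
    ContDiff ℝ ∞ (uncurry (cornerVelocity g gx T Tt Tx)) :=
  contDiff_uncurry_conj_diagFrame (contDiff_uncurry_graphVelocity hg hgx hT hTt hTx)

/-- **The corner stream function is smooth** when `g, T, P` are. [folklore] -/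
theorem contDiff_uncurry_cornerStream {g T P : ℝ → ℝ → ℝ} (hg : ContDiff ℝ ∞ (uncurry g))
    (hT : ContDiff ℝ ∞ (uncurry T)) (hP : ContDiff ℝ ∞ (uncurry P)) :
    ContDiff ℝ ∞ (uncurry (cornerStream g T P)) :=
  contDiff_const.mul (contDiff_uncurry_comp_diagFrame (contDiff_uncurry_graphStream hg hT hP))

/-! ## The U-standard corner profile -/

/-- **Tent profile** of the standard corner in frame coordinates:
`tentProfile a c ρ u = (u - a) + c - 2 · rampAt a ρ u` — slope `+1` (a horizontal arm heading east)
before the transition `[a + ρ/3, a + 2ρ/3]`, slope `-1` (a vertical arm heading south) after it,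
exactly; the apex of the two asymptotic lines is at `u = a + ρ/2`. [folklore] -/
def tentProfile (a c ρ : ℝ) (u : ℝ) : ℝ := (u - a) + c - 2 * rampAt a ρ u

/-- Unfolding the tent profile. [folklore] -/
theorem tentProfile_apply (a c ρ u : ℝ) : tentProfile a c ρ u = (u - a) + c - 2 * rampAt a ρ u := rfl

/-- **Before the transition the tent profile is the incoming line** `c + (u - a)`. [folklore] -/
theorem tentProfile_of_le {a c ρ u : ℝ} (hρ : 0 < ρ) (hu : u ≤ a + ρ / 3) :
    tentProfile a c ρ u = c + (u - a) := by
  rw [tentProfile_apply, rampAt_of_le hρ hu]; ring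

/-- **After the transition the tent profile is the outgoing line** `c + ρ - (u - a)`. [folklore] -/
theorem tentProfile_of_ge {a c ρ u : ℝ} (hρ : 0 < ρ) (hu : a + 2 * ρ / 3 ≤ u) :
    tentProfile a c ρ u = c + ρ - (u - a) := by
  rw [tentProfile_apply, rampAt_of_ge hρ hu]; ring

/-- The tent profile is smooth. [folklore] -/
theorem tentProfile_contDiff {a c ρ : ℝ} {n : ℕ∞} : ContDiff ℝ n (tentProfile a c ρ) :=
  ((contDiff_id.sub contDiff_const).add contDiff_const).sub (contDiff_const.mul rampAt_contDiff)

/-- The slope of the tent profile is `1 - 2·step ((u - a)/ρ) ∈ [-1, 1]`. [folklore] -/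
theorem hasDerivAt_tentProfile {a c ρ : ℝ} (hρ : ρ ≠ 0) (u : ℝ) :
    HasDerivAt (tentProfile a c ρ) (1 - 2 * step ((u - a) / ρ)) u := by
  have h1 : HasDerivAt (fun u => (u - a) + c) 1 u := by
    simpa using ((hasDerivAt_id u).sub_const a).add_const c
  have h2 := (hasDerivAt_rampAt (a := a) hρ u).const_mul 2
  exact h1.sub h2

omit [NormedAddCommGroup G] [NormedSpace ℝ G] in
/-- **Static corner band, incoming arm**: off the apex zone on the incoming side
(`z₀ - z₁ ≤ a + ρ/3`), the corner scalar with unit material density (`Ξₓ(t,·) = 1`, e.g. the trivial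
material map `Ξ(t,u) = u`) and the tent profile is the straight HORIZONTAL band `Gp (2 z₁ + a - c)` (a band around
`y = (c - a)/2`, transverse argument doubled by the unnormalised frame). [folklore] -/
theorem cornerScalar_eq_hBand {Gp : ℝ → G} {a c ρ : ℝ} {T Ξ Ξx : ℝ → ℝ → ℝ} {t : ℝ} {z : E²}
    (hρ : 0 < ρ) (hT : ∀ u, T t u = tentProfile a c ρ u) (hΞx : ∀ u, Ξx t u = 1)
    (hz : z 0 - z 1 ≤ a + ρ / 3) :
    cornerScalar Gp T Ξ Ξx t z = Gp (2 * z 1 + a - c) := by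
  rw [cornerScalar_apply, hT, hΞx, div_one, tentProfile_of_le hρ hz]
  congr 1; ring

omit [NormedAddCommGroup G] [NormedSpace ℝ G] in
/-- **Static corner band, outgoing arm**: off the apex zone on the outgoing side
(`a + 2ρ/3 ≤ z₀ - z₁`), the static corner scalar is the straight VERTICAL band
`Gp (2 z₀ - a - ρ - c)` (a band around `x = (a + ρ + c)/2`). [folklore] -/
theorem cornerScalar_eq_vBand {Gp : ℝ → G} {a c ρ : ℝ} {T Ξ Ξx : ℝ → ℝ → ℝ} {t : ℝ} {z : E²}
    (hρ : 0 < ρ) (hT : ∀ u, T t u = tentProfile a c ρ u) (hΞx : ∀ u, Ξx t u = 1)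
    (hz : a + 2 * ρ / 3 ≤ z 0 - z 1) :
    cornerScalar Gp T Ξ Ξx t z = Gp (2 * z 0 - a - ρ - c) := by
  rw [cornerScalar_apply, hT, hΞx, div_one, tentProfile_of_ge hρ hz]
  congr 1; ring

/-- **A static corner does not move**: with vanishing rate data (`g ≡ 0`, `gₓ ≡ 0`) and a
time-independent profile (`Tₜ ≡ 0`) the corner velocity vanishes identically. [folklore] -/
theorem cornerVelocity_eq_zero_of_static {g gx T Tt Tx : ℝ → ℝ → ℝ} {t : ℝ} {z : E²}
    (hg : g t ((diagFrame z) 0) = 0) (hgx : gx t ((diagFrame z) 0) = 0) (hTt : Tt t ((diagFrame z) 0) = 0) :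
    cornerVelocity g gx T Tt Tx t z = 0 := by
  rw [cornerVelocity_apply, graphVelocity_eq_zero hg hgx hTt, diagFrameInv_apply]
  simp [vec2_eq_zero_iff]

end PlanarKinematics

end Literature.Analysis.FluidPDE
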